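import Literature.Dynamics.NBody.AlbouyKaloshin2012Roberts

/-!
# Mass scaling for system (4) of Albouy–Kaloshin (2012)

System (4) ([AlbouyKaloshin2012] p. 540; `IsRealNormalizedCC`) is homogeneous: if `(q, δ)` is a real
normalized central configuration for masses `m`, then `(κ • q, κ⁻¹ • δ)` is one for masses `κ³ • m`
(`κ ≠ 0`).  Consequently the solution sets for proportional positive mass vectors are in bijection, and
(non-)finiteness / positive-dimensionality statements may be made for any convenient normalisation of
the masses — e.g. `(1/2,1/2,1/2,1/2,1/8)` (the Roberts file) versus `(4,4,4,4,1)` or `(1,1,1,1,1/4)`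
(the cell's Gröbner slices `certs/sym_e32`).  Elementary; recorded because the cell's certificates switch
normalisations. [cite: AlbouyKaloshin2012, system (4) p. 540]
-/

namespace Literature.Dynamics.NBody

open Finset

/-- `sqDist` is quadratic under scaling of both points. [folklore] -/
theorem sqDist_smul (κ : ℝ) (p q : ℝ × ℝ) : sqDist (κ • p) (κ • q) = κ ^ 2 * sqDist p q := by
  simp only [sqDist, Prod.smul_fst, Prod.smul_snd, smul_eq_mul]
  ring

/-- **Scaling equivariance of system (4).** If `(q, δ)` solves (4) for masses `m`, then
`(κ q, δ/κ)` solves (4) for masses `κ³ m` (`κ ≠ 0`). [cite: AlbouyKaloshin2012, system (4) p. 540] -/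
theorem isRealNormalizedCC_scale {n : ℕ} {m : Fin n → ℝ} {q : Fin n → ℝ × ℝ}
    {δ : Fin n → Fin n → ℝ} (h : IsRealNormalizedCC m q δ) {κ : ℝ} (hκ : κ ≠ 0) :
    IsRealNormalizedCC (fun l => κ ^ 3 * m l) (fun k => κ • q k) (fun k l => κ⁻¹ * δ k l) := by
  obtain ⟨hsym, hdist, hcc, hnorm⟩ := h
  refine ⟨?_, ?_, ?_, ?_⟩
  · intro k l
    show κ⁻¹ * δ k l = κ⁻¹ * δ l k
    rw [hsym k l]
  · intro k l hkl
    show (κ⁻¹ * δ k l) ^ 2 * sqDist (κ • q k) (κ • q l) = 1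
    rw [sqDist_smul, show (κ⁻¹ * δ k l) ^ 2 * (κ ^ 2 * sqDist (q k) (q l))
        = (κ⁻¹ * κ) ^ 2 * (δ k l ^ 2 * sqDist (q k) (q l)) by ring, inv_mul_cancel₀ hκ, one_pow, one_mul]
    exact hdist k l hkl
  · intro k
    show κ • q k = ∑ l, ((κ ^ 3 * m l) * (κ⁻¹ * δ k l) ^ 3) • (κ • q k - κ • q l)
    have hk := hcc k
    have : ∀ l, ((κ ^ 3 * m l) * (κ⁻¹ * δ k l) ^ 3) • (κ • q k - κ • q l)
        = κ • ((m l * δ k l ^ 3) • (q k - q l)) := by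
      intro l
      rw [← smul_sub, smul_smul, smul_smul]
      congr 1
      field_simp
    simp_rw [this, ← Finset.smul_sum]
    rw [← hk]
  · intro h0 h1
    show (κ • q ⟨1, h1⟩).2 = (κ • q ⟨0, h0⟩).2
    simp only [Prod.smul_snd, smul_eq_mul]
    rw [hnorm h0 h1]

/-- The scaling map is a bijection between the solution sets (its inverse is scaling by `κ⁻¹`), so one is
infinite iff the other is. Stated in the direction used by the cell. [folklore] -/
theorem realNormalizedCCs_infinite_of_scale {n : ℕ} {m : Fin n → ℝ}
    (h : (realNormalizedCCs m).Infinite) {κ : ℝ} (hκ : κ ≠ 0) :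
    (realNormalizedCCs (fun l => κ ^ 3 * m l)).Infinite := by
  let F : ((Fin n → ℝ × ℝ) × (Fin n → Fin n → ℝ)) → ((Fin n → ℝ × ℝ) × (Fin n → Fin n → ℝ)) :=
    fun c => (fun k => κ • c.1 k, fun k l => κ⁻¹ * c.2 k l)
  have hinj : Set.InjOn F (realNormalizedCCs m) := by
    intro c _ c' _ hcc'
    simp only [F, Prod.mk.injEq] at hcc'
    obtain ⟨h1, h2⟩ := hcc'
    ext k
    · have := congr_fun h1 k
      have := congr_arg (fun v => κ⁻¹ • v) this
      simpa [smul_smul, inv_mul_cancel₀ hκ] using congr_arg Prod.fst this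
    · have := congr_fun h1 k
      have := congr_arg (fun v => κ⁻¹ • v) this
      simpa [smul_smul, inv_mul_cancel₀ hκ] using congr_arg Prod.snd this
    · rename_i k' 
      have := congr_fun (congr_fun h2 k) k'
      simpa [inv_ne_zero hκ, hκ] using this
  have hmaps : Set.MapsTo F (realNormalizedCCs m) (realNormalizedCCs (fun l => κ ^ 3 * m l)) := by
    intro c hc
    exact isRealNormalizedCC_scale hc hκ
  exact Set.infinite_of_injOn_mapsTo hinj hmaps h

/-- Example: real normalized CCs for the integer mass vector `(4,4,4,4,1)` (= `2³ •` Roberts' masses)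
form an infinite set. [cite: AlbouyKaloshin2012, Remark 8 p. 583] -/
theorem realNormalizedCCs_4441_infinite :
    (realNormalizedCCs (fun l => (2 : ℝ) ^ 3 * robertsMasses l)).Infinite :=
  realNormalizedCCs_infinite_of_scale realNormalizedCCs_robertsMasses_infinite two_ne_zero

/-- The mass vector of the previous theorem is literally `(4,4,4,4,1)`. [folklore] -/
theorem robertsMasses_scaled : (fun l => (2 : ℝ) ^ 3 * robertsMasses l) = ![4, 4, 4, 4, 1] := by
  funext l
  fin_cases l <;> simp [robertsMasses] <;> norm_num

end Literature.Dynamics.NBody
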